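import Summits.CriticalPhenomena.PercolationContinuityZ3.Theorems.Transplant.PlanarSkeletonFrmFromDefs
import Summits.CriticalPhenomena.PercolationContinuityZ3.Theorems.Transplant.SkelFrmFromBParamsFaceRoomsAR0
import Summits.CriticalPhenomena.PercolationContinuityZ3.Theorems.Transplant.SkelFrmBParamsFaceRoomsAR0
import Summits.CriticalPhenomena.PercolationContinuityZ3.Theorems.Transplant.SkelFrmFromBParamsFaceBandAR0
import Summits.CriticalPhenomena.PercolationContinuityZ3.Theorems.Transplant.SkelFrmBParamsFaceBandAR0
import Summits.CriticalPhenomena.PercolationContinuityZ3.Theorems.Transplant.SkelFrmFromBParamsFaceCountsRangeA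
import Summits.CriticalPhenomena.PercolationContinuityZ3.Theorems.Transplant.SkelFrmBParamsFaceCountsRangeA
import Summits.CriticalPhenomena.PercolationContinuityZ3.Theorems.Transplant.PlanarCells2VFace
import Summits.CriticalPhenomena.PercolationContinuityZ3.Theorems.Transplant.SkelPhiFaceSlots2
import HarnessLib
import Summits.CriticalPhenomena.PercolationContinuityZ3.Theorems.Transplant.SkelFrmBFaceFrameRowsV
/-!
# U-WAVE PORT (RULING D-U, lead g21 2026-08-26; WAVE-U-MANIFEST v3.0 row «SkelFrmBFaceFrameRowsV» ↦ «SkelFrmFromBFaceFrameRowsV») of the tree module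
# `Transplant/SkelFrmBFaceFrameRowsV` onto the carrier `PlanarSkeletonFrmFrom` (frames only, cylinders connected from width `ℓ₀` on)

ORIGINAL TITLE: N2 (frames-only node `SamePDropOfSkeletonFrm₁`, OPEN) — (F) column, DISCHARGE LAYER, block **F-K1 (part 2, V): THE FACE-FRAME ROWS OF THE ONE-SIDED FACE KEYSTONE

builds on p205010 (kernel theorem, internal audit signed; external expert review pending) — nothing in this file uses p205010; NOTHING is claimed about the
OPEN node U `SamePDropOfSkeletonFrmFrom₁` (nor U_s / the end state).  Lane `prim-bschramm`, seat `prim-hp-8 gen 53 (U-wave port pen, family P-hp8; tool of record = p3-g26 port_u.py)`; helper file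
(`--supports stmt-CriticalPhenomena-4575 --as helper`).  PORT RULES r1–r4 of RULING D-U: declaration order and proof texts are those of the original,
byte-identical except (i) the carrier token `PlanarSkeletonFrm ↦ PlanarSkeletonFrmFrom` (binders, `namespace`/`end` lines, qualified names of twinned
declarations), (ii) carrier-FREE declarations of the original (φ-level `Skelφ…` blocks and namespace-only arithmetic residents) are NOT re-declared —
this file imports the original and `export`s the twin-free residents (POLICY T / treatment (m1)); residents whose statement mentions a twinned
constant are copied, (iii) every carrier-binding declaration keeps its explicit binder `(Φ : PlanarSkeletonFrmFrom G)` in its own signature (r2).  Docstrings and citations are the original's.  Manifest row idx 151 (level 17; flags verbatim|MIXED(m1)|RESIDENTS(T:0/free:2)); filed by the hp-8 lineage under RULING M-11 (family P-hp8).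
-/

noncomputable section

open scoped Classical

namespace Summit.CriticalPhenomena.PercolationContinuityZ3.Theorems.Transplant

open Literature.Probability.Percolation Literature.Probability.LatticeModels KNCells
open Literature.Probability.Percolation.KozmaNitzan
open Literature.Probability.Percolation.KozmaNitzan.Cells (oth oth_ne eq_oth_of_ne)
open TwoAxis.Para (modulus detD)

/-! ## §1 The frame functionals over the shifted window -/

namespace Skelφ

namespace FinePrm

variable (pr : FinePrm)

end FinePrm

end Skelφ

/-! ## §2 The frame rows of the VC keystone at the (ζ′) fine parameters -/

namespace PlanarSkeletonFrmFrom

namespace NegB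

open SimpleGraph
open SkelConc (Consts)
open Skelφ.StepI (DataN)
open Neg

section FrameRowsV

variable (κ : Consts) {V : Type} [DecidableEq V] [Countable V] {G : SimpleGraph V} [G.LocallyFinite] (Φ : PlanarSkeletonFrmFrom G) (t : V) (p : unitInterval)
  (D : Skelφ.StepI.DataNS V) (f : ℕ) (mk : ℕ) (gx : Neg.FSlot)

export PlanarSkeletonFrm.NegB (faceExtV_apply)

export PlanarSkeletonFrm.NegB (faceExtV_oth_bounds)

/-- **The `aw`-numerator of the shifted window in closed form**: `awNumV P (I,true) = (rdK I (bOf I)·(eV I + 1) + rdN I (bOf I))·D` (FaceA `awNum_eqA` at the new extent). [folklore] -/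
theorem awNumV_eq (κ : Consts) {V : Type} [DecidableEq V] [Countable V] {G : SimpleGraph V} [G.LocallyFinite] (Φ : PlanarSkeletonFrmFrom G) (t : V) (p : unitInterval) (D : Skelφ.StepI.DataNS V) (f : ℕ) (g : ℕ) (P : PCells2V) (I : Fin 2) :
    (prFA κ Φ t p D g f).awNumV P (I, true) =
      ((prFA κ Φ t p D g f).rdK I ((prFA κ Φ t p D g f).bOf I) * (P.faceExt (I, true) (oth I) + 1) + (prFA κ Φ t p D g f).rdN I ((prFA κ Φ t p D g f).bOf I)) *
        (prFA κ Φ t p D g f).D := by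
  set pr := prFA κ Φ t p D g f
  have e := (faceExtV_apply P I).1
  obtain rfl | rfl : I = 0 ∨ I = 1 := by fin_cases I <;> simp
  · show (pr.rdK 1 (pr.bOf 0) * (P.faceExt (0, true) 0 + 1) + pr.rdK 0 (pr.bOf 0) * (P.faceExt (0, true) 1 + 1)) * pr.D = _
    rw [e, Skelφ.FinePrm.rdN_zero, Skelφ.FinePrm.rdK_one, show oth (0 : Fin 2) = 1 from rfl]; ring
  · show (pr.rdK 1 (pr.bOf 1) * (P.faceExt (1, true) 0 + 1) + pr.rdK 0 (pr.bOf 1) * (P.faceExt (1, true) 1 + 1)) * pr.D = _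
    rw [e, Skelφ.FinePrm.rdN_one, Skelφ.FinePrm.rdK_zero, show oth (1 : Fin 2) = 0 from rfl]; ring

/-- **THE V BOUND OF RECORD — the contact band half-width is linear in the WINDOW extent**: `kFF₂V (prFA) P Rl I ≤ eV I + 5·Rl + 15` at `g := gT` (any `Rl`, both axes;
p1-g17's `kFF₂_le_linA` with `2r⊥ ↦ eV I = ⌈(hB I + hF I)/2⌉`). [cite: KozmaNitzan2024, §4 Lemma 10 Step IV] -/
theorem kFF₂V_le_lin (κ : Consts) {V : Type} [DecidableEq V] [Countable V] {G : SimpleGraph V} [G.LocallyFinite] (Φ : PlanarSkeletonFrmFrom G) (t : V) (p : unitInterval) (D : Skelφ.StepI.DataNS V) (f : ℕ) (mk : ℕ) (gx : Neg.FSlot) (hN : EqNumL κ Φ t p D (KS.gT mk gx κ Φ t p D) f) (hκ : (hL κ Φ t p D (KS.gT mk gx κ Φ t p D) f).natAbs ≤ 10 * nL κ Φ t p D (KS.gT mk gx κ Φ t p D) f)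
    (P : PCells2V) (Rl : ℕ) (I : Fin 2) :
    (prFA κ Φ t p D (KS.gT mk gx κ Φ t p D) f).kFF₂V P Rl I ≤ P.faceExt (I, true) (oth I) + 5 * Rl + 15 := by
  set pr := prFA κ Φ t p D (KS.gT mk gx κ Φ t p D) f
  have hDpos : 0 < pr.D := prFA_D_pos κ Φ t p D (KS.gT mk gx κ Φ t p D) f hN
  obtain ⟨hc₀, hc₁⟩ := prFA_c_pos κ Φ t p D (KS.gT mk gx κ Φ t p D) f
  have hDd := prFA_D κ Φ t p D (KS.gT mk gx κ Φ t p D) f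
  have hx : 0 < pr.rdK I (pr.bOf I) := rdK_pos_RA κ Φ t p D _ f hN I
  have hM : 0 < pr.Mabs := pr.Mabs_pos hc₀ hc₁ hDd hDpos
  have hy : pr.rdN I (pr.bOf I) ≤ pr.rdK I (pr.bOf I) * 3 := rdN_le_three_rdKA κ Φ t p D _ f hN I (eleven_le_s_TA κ Φ t p D f mk gx hN hκ I)
  have hM2 : pr.Mabs ≤ 2 * pr.rdK I (pr.bOf I) * pr.D := Mabs_le_two_rdK_DA κ Φ t p D _ f hN I
  set aw := pr.awF₂V P (I, true) with haw
  have haw' : pr.Mabs * aw ≤ pr.awNumV P (I, true) + pr.Mabs - 1 := by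
    rw [haw]; unfold Skelφ.FinePrm.awF₂V; exact Int.mul_ediv_self_le hM.ne'
  rw [awNumV_eq] at haw'
  set x := pr.rdK I (pr.bOf I)
  set y := pr.rdN I (pr.bOf I)
  set r := P.faceExt (I, true) (oth I)
  have hr0 : (0 : ℤ) ≤ r := (faceExtV_oth_bounds P I).1
  have hxD : 0 < x * pr.D := mul_pos hx hDpos
  set q := pr.kFF₂V P Rl I with hq
  have hq' : x * pr.D * q ≤ pr.Mabs * (aw + Rl + 1) + y * (Rl + 2) * pr.D + x * pr.D - 1 := by
    rw [hq]; unfold Skelφ.FinePrm.kFF₂V; exact Int.mul_ediv_self_le hxD.ne'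
  have hR0 : (0 : ℤ) ≤ Rl := Nat.cast_nonneg _
  have hyR : y * ((Rl : ℤ) + 2) * pr.D ≤ x * 3 * ((Rl : ℤ) + 2) * pr.D := by
    have : 0 ≤ ((Rl : ℤ) + 2) * pr.D := mul_nonneg (by linarith) hDpos.le
    have hy0 : 0 ≤ y := by
      show 0 ≤ pr.rdN I (pr.bOf I)
      unfold Skelφ.FinePrm.rdN; exact mul_nonneg (pr.cOf_pos hc₀ hc₁ (oth I)).le (abs_nonneg _)
    nlinarith
  have hMR : pr.Mabs * ((Rl : ℤ) + 1) ≤ 2 * x * pr.D * ((Rl : ℤ) + 1) := mul_le_mul_of_nonneg_right hM2 (by linarith)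
  have hyD : y * pr.D ≤ 3 * x * pr.D := by nlinarith
  have hlin : x * pr.D * q ≤ x * pr.D * (r + 5 * Rl + 15) - 1 := by
    have e1 : pr.Mabs * (aw + Rl + 1) = pr.Mabs * aw + pr.Mabs * ((Rl : ℤ) + 1) := by ring
    nlinarith
  have hle : x * pr.D * q < x * pr.D * (r + 5 * Rl + 15 + 1) := by nlinarith
  have := lt_of_mul_lt_mul_left hle hxD.le
  linarith

/-- The T cells underneath a V structure whose fine cells are `fcellsA`: `P.r/P.s/P.K` read off `fcellsA` (`KS.cells_of_hP` through `toPCells2T`). [folklore] -/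
theorem cells_of_hPV (κ : Consts) {V : Type} [DecidableEq V] [Countable V] {G : SimpleGraph V} [G.LocallyFinite] (Φ : PlanarSkeletonFrmFrom G) (t : V) (p : unitInterval) (D : Skelφ.StepI.DataNS V) (f : ℕ) (g : ℕ) (P : PCells2V) (hP : P.toPCells2 = fcellsA κ Φ t p D g f) :
    (∀ i, (P.r i : ℤ) = ((fcellsA κ Φ t p D g f).r i : ℤ)) ∧ (∀ i, P.s i = (fcellsA κ Φ t p D g f).s i) ∧ P.K = (fcellsA κ Φ t p D g f).K :=
  KS.cells_of_hP κ Φ t p D g f P.toPCells2T hP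

/-- **`hRlev` at the V cells**: `Rlev0 + 4 ≤ 10 · P.s i`, from the box floor. [folklore] -/
theorem frame_hRlevV (κ : Consts) {V : Type} [DecidableEq V] [Countable V] {G : SimpleGraph V} [G.LocallyFinite] (Φ : PlanarSkeletonFrmFrom G) (t : V) (p : unitInterval) (D : Skelφ.StepI.DataNS V) (f : ℕ) (mk : ℕ) (gx : Neg.FSlot) (hN : EqNumL κ Φ t p D (KS.gT mk gx κ Φ t p D) f) (hκ : (hL κ Φ t p D (KS.gT mk gx κ Φ t p D) f).natAbs ≤ 10 * nL κ Φ t p D (KS.gT mk gx κ Φ t p D) f)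
    (hMR0 : 4 * Neg.K κ * (KS0.R'0 κ Φ t p D mk + 2) ≤ ML κ Φ t p D (KS.gT mk gx κ Φ t p D))
    (P : PCells2V) (hP : P.toPCells2 = fcellsA κ Φ t p D (KS.gT mk gx κ Φ t p D) f) (i : Fin 2) :
    KS0.Rlev0 κ Φ t p D mk + 4 ≤ 10 * P.s i := by
  obtain ⟨-, hs, -⟩ := cells_of_hPV κ Φ t p D f (KS.gT mk gx κ Φ t p D) P hP
  rw [hs i]
  exact (hRlev_R0_of_box κ Φ t p D f mk gx hN hκ hMR0 i).1

/-- **`hRlev'` at the V cells (creep-aware)**: `Rlev0 + 5 + P.c du.1 ≤ 3 · P.r (oth du.1)`. [folklore] -/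
theorem frame_hRlev'V (κ : Consts) {V : Type} [DecidableEq V] [Countable V] {G : SimpleGraph V} [G.LocallyFinite] (Φ : PlanarSkeletonFrmFrom G) (t : V) (p : unitInterval) (D : Skelφ.StepI.DataNS V) (f : ℕ) (mk : ℕ) (gx : Neg.FSlot) (hN : EqNumL κ Φ t p D (KS.gT mk gx κ Φ t p D) f) (hκ : (hL κ Φ t p D (KS.gT mk gx κ Φ t p D) f).natAbs ≤ 10 * nL κ Φ t p D (KS.gT mk gx κ Φ t p D) f)
    (hMR0 : 4 * Neg.K κ * (KS0.R'0 κ Φ t p D mk + 2) ≤ ML κ Φ t p D (KS.gT mk gx κ Φ t p D))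
    (P : PCells2V) (hP : P.toPCells2 = fcellsA κ Φ t p D (KS.gT mk gx κ Φ t p D) f) (du : MDir) :
    (KS0.Rlev0 κ Φ t p D mk : ℤ) + 5 + P.c du.1 ≤ 3 * P.r (oth du.1) := by
  obtain ⟨hr, -, -⟩ := cells_of_hPV κ Φ t p D f (KS.gT mk gx κ Φ t p D) P hP
  obtain ⟨-, hu, hru⟩ := uA_oth_factsR0 κ Φ t p D f mk gx hN hκ hMR0 du.1
  have hc : P.c du.1 ≤ (P.r (oth du.1) : ℤ) := P.toPCells2T.c_le_r_oth' du.1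
  have hR := (KS0.R'0_eq κ Φ t p D mk).2.1
  have hR' : (KS0.Rlev0 κ Φ t p D mk : ℤ) + 1 = (KS0.R'0 κ Φ t p D mk : ℤ) := by exact_mod_cast hR
  change (KS0.Rlev0 κ Φ t p D mk : ℤ) + 5 + P.toPCells2T.c du.1 ≤ 3 * (P.toPCells2T.r (oth du.1) : ℤ)
  have hr' : (P.toPCells2T.r (oth du.1) : ℤ) = ((fcellsA κ Φ t p D (KS.gT mk gx κ Φ t p D) f).r (oth du.1) : ℤ) := hr (oth du.1)
  rw [hr'] at hc ⊢
  set u := (if oth du.1 = 0 then KS.u₀A κ Φ t p D (KS.gT mk gx κ Φ t p D) f else KS.u₁A κ Φ t p D (KS.gT mk gx κ Φ t p D) f)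
  linarith

/-- **`hk₀` at `k₀ := 3`** (P-free; FaceLatA). [folklore] -/
theorem frame_hk₀V (κ : Consts) {V : Type} [DecidableEq V] [Countable V] {G : SimpleGraph V} [G.LocallyFinite] (Φ : PlanarSkeletonFrmFrom G) (t : V) (p : unitInterval) (D : Skelφ.StepI.DataNS V) (f : ℕ) (mk : ℕ) (gx : Neg.FSlot) (hN : EqNumL κ Φ t p D (KS.gT mk gx κ Φ t p D) f) (hκ : (hL κ Φ t p D (KS.gT mk gx κ Φ t p D) f).natAbs ≤ 10 * nL κ Φ t p D (KS.gT mk gx κ Φ t p D) f)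
    (I : Fin 2) :
    (prFA κ Φ t p D (KS.gT mk gx κ Φ t p D) f).rdN I ((prFA κ Φ t p D (KS.gT mk gx κ Φ t p D) f).bOf I) ≤
      (prFA κ Φ t p D (KS.gT mk gx κ Φ t p D) f).rdK I ((prFA κ Φ t p D (KS.gT mk gx κ Φ t p D) f).bOf I) * 3 :=
  rdN_le_three_rdKA κ Φ t p D _ f hN I (eleven_le_s_TA κ Φ t p D f mk gx hN hκ I)

/-- **`hk₀'` at the V cells** (`k₀ := 3`): `3 · P.r i + 3 + 3 ≤ 5 · P.r i`. [folklore] -/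
theorem frame_hk₀'V (κ : Consts) {V : Type} [DecidableEq V] [Countable V] {G : SimpleGraph V} [G.LocallyFinite] (Φ : PlanarSkeletonFrmFrom G) (t : V) (p : unitInterval) (D : Skelφ.StepI.DataNS V) (f : ℕ) (mk : ℕ) (gx : Neg.FSlot) (hN : EqNumL κ Φ t p D (KS.gT mk gx κ Φ t p D) f) (hκ : (hL κ Φ t p D (KS.gT mk gx κ Φ t p D) f).natAbs ≤ 10 * nL κ Φ t p D (KS.gT mk gx κ Φ t p D) f)
    (P : PCells2V) (hP : P.toPCells2 = fcellsA κ Φ t p D (KS.gT mk gx κ Φ t p D) f) (i : Fin 2) :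
    3 * (P.r i : ℤ) + 3 + 3 ≤ 5 * P.r i := by
  obtain ⟨hr, -, -⟩ := cells_of_hPV κ Φ t p D f (KS.gT mk gx κ Φ t p D) P hP
  rw [show (P.r i : ℤ) = ((fcellsA κ Φ t p D (KS.gT mk gx κ Φ t p D) f).r i : ℤ) from hr i]
  exact hk₀'_RA κ Φ t p D f mk gx hN hκ (k₀ := 3) le_rfl i

/-- **`hroomF` at the RE-SIZED window** (level `Rlev0`): `aw du := (awF₂V P du).toNat`, `kF := kFF₂V P Rlev0` (`Skelφ.FinePrm.hroomF_kFF₂V`). [cite: KozmaNitzan2024, §4 Lemma 12 (pp. 23–25)] -/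
theorem frame_hroomFV (κ : Consts) {V : Type} [DecidableEq V] [Countable V] {G : SimpleGraph V} [G.LocallyFinite] (Φ : PlanarSkeletonFrmFrom G) (t : V) (p : unitInterval) (D : Skelφ.StepI.DataNS V) (f : ℕ) (mk : ℕ) (gx : Neg.FSlot) (hN : EqNumL κ Φ t p D (KS.gT mk gx κ Φ t p D) f) (P : PCells2V) (du : MDir) :
    (prFA κ Φ t p D (KS.gT mk gx κ Φ t p D) f).Mabs *
          (((((prFA κ Φ t p D (KS.gT mk gx κ Φ t p D) f).awF₂V P du).toNat : ℕ) : ℤ) + (KS0.Rlev0 κ Φ t p D mk : ℤ) + 1) +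
        (prFA κ Φ t p D (KS.gT mk gx κ Φ t p D) f).rdN du.1 ((prFA κ Φ t p D (KS.gT mk gx κ Φ t p D) f).bOf du.1) * ((KS0.Rlev0 κ Φ t p D mk : ℤ) + 2) *
          (prFA κ Φ t p D (KS.gT mk gx κ Φ t p D) f).D ≤
      (prFA κ Φ t p D (KS.gT mk gx κ Φ t p D) f).rdK du.1 ((prFA κ Φ t p D (KS.gT mk gx κ Φ t p D) f).bOf du.1) *
        (prFA κ Φ t p D (KS.gT mk gx κ Φ t p D) f).kFF₂V P (KS0.Rlev0 κ Φ t p D mk) du.1 * (prFA κ Φ t p D (KS.gT mk gx κ Φ t p D) f).D := by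
  set pr := prFA κ Φ t p D (KS.gT mk gx κ Φ t p D) f
  obtain ⟨hc₀, hc₁⟩ := prFA_c_pos κ Φ t p D (KS.gT mk gx κ Φ t p D) f
  have hDd := prFA_D κ Φ t p D (KS.gT mk gx κ Φ t p D) f
  have hDpos := prFA_D_pos κ Φ t p D (KS.gT mk gx κ Φ t p D) f hN
  have hM := pr.Mabs_pos hc₀ hc₁ hDd hDpos
  have hnn : 0 ≤ pr.awF₂V P du := by
    have hfe : ∀ i : Fin 2, 0 ≤ P.faceExt du i := fun i => by
      unfold PCells2V.faceExt; split_ifs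
      · exact le_rfl
      · have h3 : (0 : ℤ) ≤ P.hB du.1 := Nat.cast_nonneg _; have h4 : (0 : ℤ) ≤ P.hF du.1 := Nat.cast_nonneg _; omega
    have hrd : ∀ I b, 0 ≤ pr.rdK I b := fun I b => by
      unfold Skelφ.FinePrm.rdK; exact mul_nonneg (pr.cOf_pos hc₀ hc₁ I).le (abs_nonneg _)
    have hnum : 0 ≤ pr.awNumV P du := by
      unfold Skelφ.FinePrm.awNumV
      have := hfe 0; have := hfe 1; have := hrd 1 (pr.bOf du.1); have := hrd 0 (pr.bOf du.1)
      positivity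
    unfold Skelφ.FinePrm.awF₂V
    exact Int.ediv_nonneg (by linarith) hM.le
  rw [Int.toNat_of_nonneg hnn]
  exact pr.hroomF_kFF₂V hc₀ hc₁ hDd hDpos P (KS0.Rlev0 κ Φ t p D mk) du

/-- **`haw` at the RE-SIZED window** (`Skelφ.FinePrm.haw_awF₂V`, over the NEW `PCells2V.faceExt`) with `aw du := (awF₂V P du).toNat`. [cite: KozmaNitzan2024, §4 Lemma 12 (pp. 23–25)] -/
theorem frame_hawV (κ : Consts) {V : Type} [DecidableEq V] [Countable V] {G : SimpleGraph V} [G.LocallyFinite] (Φ : PlanarSkeletonFrmFrom G) (t : V) (p : unitInterval) (D : Skelφ.StepI.DataNS V) (f : ℕ) (mk : ℕ) (gx : Neg.FSlot) (hN : EqNumL κ Φ t p D (KS.gT mk gx κ Φ t p D) f) (P : PCells2V) (du : MDir) :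
    ((prFA κ Φ t p D (KS.gT mk gx κ Φ t p D) f).rdK 1 ((prFA κ Φ t p D (KS.gT mk gx κ Φ t p D) f).bOf du.1) * (P.faceExt du 0 + 1) +
          (prFA κ Φ t p D (KS.gT mk gx κ Φ t p D) f).rdK 0 ((prFA κ Φ t p D (KS.gT mk gx κ Φ t p D) f).bOf du.1) * (P.faceExt du 1 + 1)) *
        (prFA κ Φ t p D (KS.gT mk gx κ Φ t p D) f).D ≤
      (prFA κ Φ t p D (KS.gT mk gx κ Φ t p D) f).Mabs *
        (((((prFA κ Φ t p D (KS.gT mk gx κ Φ t p D) f).awF₂V P du).toNat : ℕ) : ℤ) + 1) := by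
  set pr := prFA κ Φ t p D (KS.gT mk gx κ Φ t p D) f
  obtain ⟨hc₀, hc₁⟩ := prFA_c_pos κ Φ t p D (KS.gT mk gx κ Φ t p D) f
  have hDd := prFA_D κ Φ t p D (KS.gT mk gx κ Φ t p D) f
  have hDpos := prFA_D_pos κ Φ t p D (KS.gT mk gx κ Φ t p D) f hN
  have h := pr.haw_awF₂V hc₀ hc₁ hDd hDpos P du
  have hto : pr.awF₂V P du ≤ (((pr.awF₂V P du).toNat : ℕ) : ℤ) := Int.self_le_toNat _
  have hM := pr.Mabs_pos hc₀ hc₁ hDd hDpos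
  nlinarith

/-- **`hkF` at the RE-SIZED window, DESIGN W's shape with the extra `r⊥`**: `kFF₂V P Rlev0 I + 3 + P.c I + P.r (oth I) ≤ 5 · P.r (oth I)`
(`kFF₂V ≤ eV + 5Rlev0 + 15`, `eV ≤ 2r⊥`, `c ≤ r⊥`, `Rlev0 + 1 = R'0`, `6R'0 + 11 ≤ u_⊥`, `40u_⊥ ≤ r_⊥`). [cite: KozmaNitzan2024, §4 Lemma 10 Step IV] -/
theorem frame_hkFV (κ : Consts) {V : Type} [DecidableEq V] [Countable V] {G : SimpleGraph V} [G.LocallyFinite] (Φ : PlanarSkeletonFrmFrom G) (t : V) (p : unitInterval) (D : Skelφ.StepI.DataNS V) (f : ℕ) (mk : ℕ) (gx : Neg.FSlot) (hN : EqNumL κ Φ t p D (KS.gT mk gx κ Φ t p D) f) (hκ : (hL κ Φ t p D (KS.gT mk gx κ Φ t p D) f).natAbs ≤ 10 * nL κ Φ t p D (KS.gT mk gx κ Φ t p D) f)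
    (hMR0 : 4 * Neg.K κ * (KS0.R'0 κ Φ t p D mk + 2) ≤ ML κ Φ t p D (KS.gT mk gx κ Φ t p D))
    (P : PCells2V) (hP : P.toPCells2 = fcellsA κ Φ t p D (KS.gT mk gx κ Φ t p D) f) (I : Fin 2) :
    (prFA κ Φ t p D (KS.gT mk gx κ Φ t p D) f).kFF₂V P (KS0.Rlev0 κ Φ t p D mk) I + 3 + P.c I + P.r (oth I) ≤ 5 * (P.r (oth I) : ℤ) := by
  obtain ⟨hr, -, -⟩ := cells_of_hPV κ Φ t p D f (KS.gT mk gx κ Φ t p D) P hP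
  have hq := kFF₂V_le_lin κ Φ t p D f mk gx hN hκ P (KS0.Rlev0 κ Φ t p D mk) I
  obtain ⟨he0, he2⟩ := faceExtV_oth_bounds P I
  obtain ⟨-, hu, hru⟩ := uA_oth_factsR0 κ Φ t p D f mk gx hN hκ hMR0 I
  have hc : P.c I ≤ (P.r (oth I) : ℤ) := P.toPCells2T.c_le_r_oth' I
  have hR := (KS0.R'0_eq κ Φ t p D mk).2.1
  have hR' : (KS0.Rlev0 κ Φ t p D mk : ℤ) + 1 = (KS0.R'0 κ Φ t p D mk : ℤ) := by exact_mod_cast hR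
  change _ + 3 + P.toPCells2T.c I + (P.toPCells2T.r (oth I) : ℤ) ≤ 5 * (P.toPCells2T.r (oth I) : ℤ)
  have hr' : (P.toPCells2T.r (oth I) : ℤ) = ((fcellsA κ Φ t p D (KS.gT mk gx κ Φ t p D) f).r (oth I) : ℤ) := hr (oth I)
  have he2' : P.faceExt (I, true) (oth I) ≤ 2 * ((fcellsA κ Φ t p D (KS.gT mk gx κ Φ t p D) f).r (oth I) : ℤ) := by rw [← hr']; exact he2
  rw [hr'] at hc ⊢
  set q := (prFA κ Φ t p D (KS.gT mk gx κ Φ t p D) f).kFF₂V P (KS0.Rlev0 κ Φ t p D mk) I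
  set e := P.faceExt (I, true) (oth I)
  set u := (if oth I = 0 then KS.u₀A κ Φ t p D (KS.gT mk gx κ Φ t p D) f else KS.u₁A κ Φ t p D (KS.gT mk gx κ Φ t p D) f)
  linarith

/-- **`hnC`/`hU3`** (P-free; FaceRoomsA `nFc_RA`) at `nFc I := (pr.cOf I · |pr.A| · |pr.lvGen I (pr.bOf I)|).toNat`. [folklore] -/
theorem frame_nFcV (κ : Consts) {V : Type} [DecidableEq V] [Countable V] {G : SimpleGraph V} [G.LocallyFinite] (Φ : PlanarSkeletonFrmFrom G) (t : V) (p : unitInterval) (D : Skelφ.StepI.DataNS V) (f : ℕ) (mk : ℕ) (gx : Neg.FSlot) (hN : EqNumL κ Φ t p D (KS.gT mk gx κ Φ t p D) f) (hκ : (hL κ Φ t p D (KS.gT mk gx κ Φ t p D) f).natAbs ≤ 10 * nL κ Φ t p D (KS.gT mk gx κ Φ t p D) f)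
    (I : Fin 2) :
    ((((prFA κ Φ t p D (KS.gT mk gx κ Φ t p D) f).cOf I * |(prFA κ Φ t p D (KS.gT mk gx κ Φ t p D) f).A| *
            |(prFA κ Φ t p D (KS.gT mk gx κ Φ t p D) f).lvGen I ((prFA κ Φ t p D (KS.gT mk gx κ Φ t p D) f).bOf I)|).toNat : ℕ) : ℤ) ≤
        (prFA κ Φ t p D (KS.gT mk gx κ Φ t p D) f).cOf I * |(prFA κ Φ t p D (KS.gT mk gx κ Φ t p D) f).A| *
          |(prFA κ Φ t p D (KS.gT mk gx κ Φ t p D) f).lvGen I ((prFA κ Φ t p D (KS.gT mk gx κ Φ t p D) f).bOf I)| ∧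
      (prFA κ Φ t p D (KS.gT mk gx κ Φ t p D) f).D ≤
        3 * ((((prFA κ Φ t p D (KS.gT mk gx κ Φ t p D) f).cOf I * |(prFA κ Φ t p D (KS.gT mk gx κ Φ t p D) f).A| *
            |(prFA κ Φ t p D (KS.gT mk gx κ Φ t p D) f).lvGen I ((prFA κ Φ t p D (KS.gT mk gx κ Φ t p D) f).bOf I)|).toNat : ℕ) : ℤ) := by
  obtain ⟨h0, h3⟩ := nFc_RA κ Φ t p D f mk gx hN hκ I
  rw [Int.toNat_of_nonneg h0]
  exact ⟨le_rfl, h3⟩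

end FrameRowsV

end NegB

end PlanarSkeletonFrmFrom

end Summit.CriticalPhenomena.PercolationContinuityZ3.Theorems.Transplant

end
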